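import Summits.ResolutionOfSingularities.ResolutionOfSingularities.Theorems.PurelyInseparableDim4E2OfCJSRows
import Literature.AlgebraicGeometry.Resolution.StalkIdealLemmas
import Literature.AlgebraicGeometry.Resolution.SNCStrataSmooth
import Literature.AlgebraicGeometry.Resolution.DirectrixSchemeLocal
import Literature.AlgebraicGeometry.CossartJannsenSaito2020.KeyTheoremsLocalLinks
import HarnessLib

/-!
# F4-I(3,3) from CJS — a building block of row (M-b): an open-immersion CHART on which the marked ideal reads
# `(z³ + F)·𝒪` PRESENTS the hypersurface at the chart's point (cell `res-dim4-pi`, WORD #52 (c) / #59 (a))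

[OURS · counted 0 · AI work weaker than expert review.]  Cell `res-dim4-pi` (D-0157 DOOR 2), seat `res-dim4-p-2`
g2 (row holder), for res-dim4-p-7 g2's row (M-b) `E2OfCJS.LocalizationRow` (p665567).  NOTHING here proves
(M-b), `NoIsolatedTrap 3 3`, or resolution of singularities in dimension ≥ 4 / characteristic `p`.

For an ambient `Z`, an ideal sheaf `M`, an open immersion `φ : 𝔸⁵_K ⟶ Z` with `M.comap φ = hypSheaf 3 F`
(typ-3's INVARIANT / `E2OfCJS.GStage`), DEF-FREE:
* `presentedBy_of_chart_stalk` — `𝒪_{Z, φ 0} ⧸ M_{φ 0} ≃+* HypStalk K F` (the stalk map of an open immersion is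
  an isomorphism — Mathlib; it carries `M_{φ 0}` to `(M.comap φ)_0 = (hypSheaf 3 F)_0` — the tree's
  `stalkIdeal_comap_eq_map_stalkMap`);
* **`presentedBy_subscheme_of_chart`** — the hypersurface `X = V(M) ⊂ Z` is PRESENTED by `F` at its point over
  `φ 0`: `E2OfCJS.PresentedBy K F M.subscheme c` whenever `M.subschemeι c = φ 0` (the tree's
  `nonempty_stalkSubschemeEquiv`: `𝒪_{V(M), c} ≃+* 𝒪_{Z, ι c} ⧸ M_{ι c}`).
With it, (M-b)'s presentations at `S i = Spec 𝒪_{X_i, x_i}` reduce to «the stalk of `Spec R` at its closed point is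
`R`», and at `B i` to `isIso_stalkMap_pullback_fst_fromSpecStalk` plus this lemma one stage up.
bears_on: LADDER-RESOLUTION:D157-DOOR2 (res-dim4-pi · F4-I(3,3) · CJS dictionary · row M-b block).  Supports
stmt-ResolutionOfSingularities-16155 (helper).
-/

set_option linter.dupNamespace false -- mandated namespace of this single-conjunct summit

noncomputable section

open CategoryTheory AlgebraicGeometry TopologicalSpace
open Literature.AlgebraicGeometry.Resolution
open Literature.AlgebraicGeometry.Resolution.AffinePointBlowup (P A ξ)
open Scheme.IdealSheafData

namespace Summit.ResolutionOfSingularities.ResolutionOfSingularities.Theorems.PIDim4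

namespace E2OfCJS

variable {K : Type} [Field K]

/-- **`𝒪_{Z, φ 0} ⧸ M_{φ 0} ≃+* HypStalk K F`** for an open-immersion chart `φ : 𝔸⁵_K ⟶ Z` with
`M.comap φ = hypSheaf 3 F`: the stalk map of `φ` at the origin is a ring isomorphism carrying the stalk of `M`
onto the stalk of `hypSheaf 3 F`. [folklore] -/
theorem presentedBy_of_chart_stalk {Z : Scheme.{0}} (M : Z.IdealSheafData) (φ : P 4 K ⟶ Z) [IsOpenImmersion φ]
    (F : MvPolynomial (Fin 4) K) (hM : M.comap φ = hypSheaf 3 F) :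
    Nonempty ((Z.presheaf.stalk (φ (ξ 4 K)) ⧸ stalkIdeal M (φ (ξ 4 K))) ≃+* HypStalk K F) := by
  let e : Z.presheaf.stalk (φ (ξ 4 K)) ≅ (P 4 K).presheaf.stalk (ξ 4 K) := asIso (φ.stalkMap (ξ 4 K))
  have h : (stalkIdeal M (φ (ξ 4 K))).map e.hom.hom = stalkIdeal (hypSheaf 3 F) (ξ 4 K) := by
    rw [← hM, stalkIdeal_comap_eq_map_stalkMap]
    rfl
  exact ⟨Ideal.quotientEquiv _ _ e.commRingCatIsoToRingEquiv (by rw [← h]; rfl)⟩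

/-- **THE HYPERSURFACE IS PRESENTED AT THE CHART'S POINT**: for `M : Z.IdealSheafData`, an open immersion
`φ : 𝔸⁵_K ⟶ Z` with `M.comap φ = hypSheaf 3 F`, and a point `c` of the closed subscheme `V(M)` lying at
`φ 0`, the local ring `𝒪_{V(M), c}` is the local ring of `z³ + F = 0` at the origin:
`PresentedBy K F M.subscheme c`. [folklore] -/
theorem presentedBy_subscheme_of_chart {Z : Scheme.{0}} (M : Z.IdealSheafData) (φ : P 4 K ⟶ Z)
    [IsOpenImmersion φ] (F : MvPolynomial (Fin 4) K) (hM : M.comap φ = hypSheaf 3 F) (c : M.subscheme)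
    (hc : M.subschemeι c = φ (ξ 4 K)) : PresentedBy K F M.subscheme c := by
  obtain ⟨e₁⟩ := nonempty_stalkSubschemeEquiv M c
  obtain ⟨e₂⟩ := presentedBy_of_chart_stalk M φ F hM
  -- transport `e₂` from `φ 0` to `ι c` along `hc`
  have e₂' : Nonempty ((Z.presheaf.stalk (M.subschemeι c) ⧸ stalkIdeal M (M.subschemeι c)) ≃+* HypStalk K F) := by
    rw [hc]; exact ⟨e₂⟩
  obtain ⟨e₃⟩ := e₂'
  exact ⟨(e₁.symm.trans e₃).toCommRingCatIso⟩

/-! ## Appended 2026-08-28T20:5xZ: transport of presentations (for (M-b)'s local schemes) -/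

/-- A presentation transports along an isomorphism of local rings. [folklore] -/
theorem PresentedBy.of_stalkIso {F : MvPolynomial (Fin 4) K} {X Y : Scheme.{0}} {x : X} {y : Y}
    (e : X.presheaf.stalk x ≅ Y.presheaf.stalk y) (h : PresentedBy K F Y y) : PresentedBy K F X x := by
  obtain ⟨e'⟩ := h
  exact ⟨e ≪≫ e'⟩

/-- **The local scheme `Spec 𝒪_{X,x}` at its closed point is presented by whatever presents `(X, x)`** (the stalk
map of `Spec 𝒪_{X,x} ⟶ X` at the closed point is an isomorphism onto `𝒪_{X,x}` — the tree's
`isIso_stalkMap_fromSpecStalk`). With `isLocalAt_Spec_closedPoint` this is (M-b)'s `S i = Spec 𝒪_{X_i,x_i}`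
presentation. [folklore] -/
theorem PresentedBy.spec_stalk {F : MvPolynomial (Fin 4) K} {X : Scheme.{0}} {x : X} (h : PresentedBy K F X x) :
    PresentedBy K F (Spec (X.presheaf.stalk x)) (IsLocalRing.closedPoint (X.presheaf.stalk x)) := by
  haveI := isIso_stalkMap_fromSpecStalk X x (IsLocalRing.closedPoint (X.presheaf.stalk x))
  exact PresentedBy.of_stalkIso
    ((asIso ((X.fromSpecStalk x).stalkMap (IsLocalRing.closedPoint (X.presheaf.stalk x)))).symm ≪≫
      eqToIso (by rw [Scheme.fromSpecStalk_closedPoint])) h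

/-- `Spec 𝒪_{X,x}` is local at its closed point (re-export of the tree's `isLocalAt_Spec_closedPoint` in the
shape (M-b) consumes). [folklore] -/
theorem isLocalAt_spec_stalk {X : Scheme.{0}} (x : X) :
    Literature.AlgebraicGeometry.CossartJannsenSaito2020.IsLocalAt (Spec (X.presheaf.stalk x))
      (IsLocalRing.closedPoint (X.presheaf.stalk x)) :=
  Literature.AlgebraicGeometry.CossartJannsenSaito2020.isLocalAt_Spec_closedPoint _

end E2OfCJS

end Summit.ResolutionOfSingularities.ResolutionOfSingularities.Theorems.PIDim4

end
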